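import Literature.Computability.Cryptography.LiuPassCondFamilyProofs
import HarnessLib

/-!
# Liu–Pass, *On one-way functions and Kolmogorov complexity*, Thm 3.1 (a) ⇒ (c), (a) ⇒ (b): discharged

D-0014 companion of `Sweep1Proofs.lean` closing, unconditionally, its two named facts for the
*forward* direction of Liu–Pass's Main Theorem (FOCS 2020, arXiv:2009.11514v1, §3, Thm 3.1:
"(a) the existence of one-way functions; (b) the existence of a polynomial `t(n) > 0` such that
`K^t` is mildly hard-on-average; (c) for all constants `d > 0, ε > 0`, and every polynomial
`t(n) ≥ (1+ε)n`, `K^t` is mildly hard-on-average to `(d log n)`-approximate", proved in print "by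
showing that (b) implies (a) (in Section 4) and next that (a) implies (c) (in Section 5). Finally,
(c) trivially implies (b)"):

* `isMildlyHardOnAverage_liuPassKt_of_OWFExist_holds` — (a) ⇒ (c) specialised to exact
  computation, i.e. the remark following Thm 3.1 ("for every polynomial `t(n) ≥ (1+ε)n` … mild
  average-case hardness of `K^t` is equivalent to the existence of one-way functions"), forward
  half: if one-way functions exist then `K^t` is mildly hard-on-average for *every* efficient
  universal machine `U` and *every* polynomial `t(n) ≥ (1+ε)n`;
* `exists_isMildlyHardOnAverage_liuPassKt_of_OWFExist_holds` — (a) ⇒ (b): hence for *some*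
  polynomial `t` (take `t = 2X`, `ε = 1`; this is print's "(c) trivially implies (b)").

Nothing is proved here beyond composing results already in the tree, exactly along print's §5:

* Thm 5.5 (cond EP-PRGs from OWFs: Lemma 5.4 regular `𝒮`-OWFs, Lemma 5.3 via the Leftover Hash
  Lemma and the Goldreich–Levin theorem for `𝒮`-hiding functions, Appendix Thm [GL89]) is
  `condEPPRG_of_OWFExist_holds` (`LiuPassCondFamilyProofs.lean`; the Goldreich–Levin theorem is
  `goldreichLevin_hiding_len_holds` / `GLInv.goldreichLevin_hiding_len_of_eff`,
  `GoldreichLevinHidingLenProofs.lean`, `GoldreichLevinTheorem.lean`);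
* Thm 5.5 ⇒ `K^t` mildly HoA for every `t(n) ≥ (1+ε)n` (Thm 5.6, rate-1 padding, and Thm 5.2,
  entropy/counting) is `isMildlyHardOnAverage_liuPassKt_of_OWFExist_of_h55`
  (`LiuPassPaddingProofs.lean`, with Thm 5.2 proved in `LiuPassCondEPPRG.lean` /
  `LiuPassPadding.lean`);
* (c) ⇒ (b) at `t = 2X` is `exists_isMildlyHardOnAverage_liuPassKt_of_OWFExist_of_forward`
  (`Sweep1Proofs.lean`).

This is a separate leaf module rather than an appendix to `Sweep1Proofs.lean` because the whole
Liu–Pass / Goldreich–Levin chain imports `Sweep1Proofs.lean` (via `LiuPassWeakOWF.lean`); nothing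
needs to import the present file. (The equivalence forms, Thm 1.1 = Thm 3.1 (a) ⇔ (b) and the
per-`t` S02, are discharged in `LiuPassMainTheorem.lean`.)

## References

* Y. Liu, R. Pass, *On one-way functions and Kolmogorov complexity*, FOCS 2020, 1243–1254,
  doi:10.1109/FOCS46700.2020.00118; arXiv:2009.11514v1: §3, Thm 3.1 (Main Theorem) and the
  remark following it (p. 9); §5 (Thm 5.2, Lemmas 5.3–5.4, Thms 5.5–5.6); Appendix (Thm [GL89]).
* O. Goldreich, L. A. Levin, *A hard-core predicate for all one-way functions*, STOC 1989, 25–32.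
-/

namespace Literature.Computability.Cryptography

/-- **Liu–Pass 2020, Thm 3.1 (a) ⇒ (c) specialised to exact computation (the remark following
Thm 3.1, forward half), discharged**: if one-way functions exist then, for every efficient universal
machine `U` and every polynomial `t` with `t(n) ≥ (1+ε)n` for some `ε > 0`, the `t`-time-bounded
Kolmogorov complexity `K^t` is mildly hard-on-average — the named fact
`isMildlyHardOnAverage_liuPassKt_of_OWFExist` of `Sweep1Proofs.lean`. Print's §5 route: OWF ⇒
(Thm 5.5, `condEPPRG_of_OWFExist_holds`) cond EP-PRGs ⇒ (Thm 5.6 padding, Thm 5.2)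
`K^t` mildly HoA (`isMildlyHardOnAverage_liuPassKt_of_OWFExist_of_h55`).
[Y. Liu, R. Pass, FOCS 2020, Thm 3.1 (a) ⇒ (c) and the remark following it; §5;
arXiv:2009.11514v1 p. 9] [cite: LiuPassFOCS2020, Thm 3.1 (a)⇒(c) and the remark following it; Thm 5.2] -/
theorem isMildlyHardOnAverage_liuPassKt_of_OWFExist_holds :
    isMildlyHardOnAverage_liuPassKt_of_OWFExist :=
  isMildlyHardOnAverage_liuPassKt_of_OWFExist_of_h55 condEPPRG_of_OWFExist_holds

/-- **Liu–Pass 2020, Thm 3.1 (Main Theorem) (a) ⇒ (b), discharged**: if one-way functions exist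
then, for every efficient universal machine `U`, there is a polynomial `t` — with `t(n) ≥ (1+ε)n`
for some `ε > 0`, the regime of clause (c) — such that `K^t` is mildly hard-on-average; the named
fact `exists_isMildlyHardOnAverage_liuPassKt_of_OWFExist` of `Sweep1Proofs.lean`. As in print,
"(a) implies (c) (Section 5); (c) trivially implies (b)": the per-`t` forward direction
(`isMildlyHardOnAverage_liuPassKt_of_OWFExist_holds`) at `t = 2X`, `ε = 1`
(`exists_isMildlyHardOnAverage_liuPassKt_of_OWFExist_of_forward`).
[Y. Liu, R. Pass, FOCS 2020, Thm 3.1 (a) ⇒ (b); arXiv:2009.11514v1 §3 (p. 9), §5]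
[cite: LiuPassFOCS2020, Thm 3.1 (a)⇒(b); Thms 5.2, 5.5, 5.6] -/
theorem exists_isMildlyHardOnAverage_liuPassKt_of_OWFExist_holds :
    exists_isMildlyHardOnAverage_liuPassKt_of_OWFExist :=
  exists_isMildlyHardOnAverage_liuPassKt_of_OWFExist_of_forward
    isMildlyHardOnAverage_liuPassKt_of_OWFExist_holds

end Literature.Computability.Cryptography
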